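import Mathlib
import Literature.Computability.AlgebraicComplexity.PermanentIrreducible
import Literature.Computability.AlgebraicComplexity.StandardFamiliesProofs

/-!
# Crux `DivisionGap.PerCofactorDegreeReduction` (stmt-ValiantsHypothesis-15046), line `Sketch` —
# stub `stub_automaticPositivity`: automatic positivity of low-degree cofactors of the permanent

**Theorem (`stub_automaticPositivity`).** Let `q ∈ ℝ[x_ij]` (`n × n` variables) have total degree
`≤ n + 1`.  If every coefficient of `per_n · q` is nonnegative, then every coefficient of `q` is
nonnegative.  (Sharp: at `n = 2`, `per₂ · (a² − ab + b²) = a³ + b³` with `a = x₀₀x₁₁`,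
`b = x₀₁x₁₀`, `deg q = 4 = n + 2`.)  In the line's composition this makes the positivisation step
K2 vacuous below cofactor degree `n + 2`.

## Proof

Fix an exponent `γ` in the support of `q`; its support `Γ ⊆ [n]²` has
`|Γ| ≤ Σ γ ≤ deg q ≤ n + 1` cells (`MvPolynomial.le_totalDegree`).

* **Combinatorial core** (`exists_rigid_perm`): for every `Γ ⊆ [n]²` with `|Γ| ≤ n + 1` there is
  a permutation `ρ` (occupying the cells `(ρ j, j)`, the convention of the tree's `permMonomial`)
  which is the UNIQUE perfect matching of the bipartite graph `graph(ρ) ∪ Γ`: every permutation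
  `σ` with `σ j = ρ j ∨ (σ j, j) ∈ Γ` for all `j` equals `ρ`.  Order the rows by the injective key
  `i ↦ (d(i), i)` (lexicographic; `d(i)` = number of `Γ`-cells in row `i`), and let the allowed
  set of column `j` be `A_j = {i : key i ≤ key i' for every Γ-cell (i', j)}` (an initial segment
  of the key order; all rows if column `j` is empty).  HALL's condition holds for `(A_j)_j`
  (`hall_condition`): if some column of `J` is empty then `⋃_J A_j` is everything; otherwise let
  `i_j` be the key-minimal row of column `j`, let `j⋆ ∈ J` maximise `key i_j` and `S := A_{j⋆}`
  (`⊆ ⋃_J A_j`); `j ↦ (i_j, j)` injects `J` into the `Γ`-cells with rows in `S`, so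
  `|J| ≤ Σ_{i ∈ S} d(i)`; if this exceeds `|S|` then some row of `S` has degree `≥ 2`, hence
  (keys are sorted by degree first) every row outside `S` has degree `≥ 2`, and
  `n + 1 ≥ |Γ| ≥ (|S| + 1) + 2 (n − |S|)` forces `|S| = n ≥ |J|` (`card_univ_le_of_sum_lt`).
  Mathlib's Hall theorem (`Finset.all_card_le_biUnion_card_iff_exists_injective`) gives an
  injective, hence bijective, `ρ` with `ρ j ∈ A_j`.  UNIQUENESS: if `σ j = ρ j ∨ (σ j, j) ∈ Γ` for
  all `j` then `key (ρ j) ≤ key (σ j)` for all `j`, i.e. the permutation `τ = ρ ∘ σ⁻¹` satisfies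
  `key (τ i) ≤ key i`; such a permutation is the identity (`perm_apply_eq_self_of_key_le`: `τ`
  maps the finite initial segment `{key ≤ key i}` injectively into itself, hence onto itself, and
  the preimage `i'` of `i` has `key i ≤ key i' ≤ key i`).
* **Coefficient extraction** (`coeff_permMonomial_add_mul`): with `per_n = Σ_σ x^{μ_σ}`
  (`perPoly_eq_sum_monomial`), `coeff (μ_ρ + γ) (per_n · q) = Σ_σ [μ_σ ≤ μ_ρ + γ] q_{μ_ρ+γ−μ_σ}`
  (`MvPolynomial.coeff_monomial_mul'`), and `μ_σ ≤ μ_ρ + γ` says exactly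
  `σ j = ρ j ∨ (σ j, j) ∈ supp γ` (`permMonomial_apply`), so only `σ = ρ` contributes:
  `coeff (μ_ρ + γ) (per_n · q) = q_γ`, which is `≥ 0` by hypothesis.

Design: no definitions; the row key is passed to the helper lemmas as an abstract injective map
into a linear order, monotone with respect to the row degree, and instantiated with
`toLex (d(i), i) : ℕ ×ₗ Fin n` in `exists_rigid_perm`.  Everything is over `Fin n` for all `n`
(vacuous bookkeeping at `n = 0, 1`).  Leans on Mathlib and the tree file
`Literature/Computability/AlgebraicComplexity/PermanentIrreducible.lean` only.
-/

noncomputable section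

-- `Summit.ValiantsHypothesis.ValiantsHypothesis.…` is the tree's mandated single-conjunct layout
-- (Problem = Summit), so the duplicated namespace component is intended.
set_option linter.dupNamespace false

namespace Summit.ValiantsHypothesis.ValiantsHypothesis.Theorems.DivisionGap.PerCofactorDegreeReduction.AutomaticPositivity

open MvPolynomial Literature.Computability.AlgebraicComplexity
open scoped NNReal BigOperators

variable {n : ℕ}

/-! ### Counting cells by rows -/

/-- The number of cells of `Γ` with row in `S` is the sum over `i ∈ S` of the row degrees
`d(i) = #{cells of Γ in row i}`. [folklore] -/
theorem card_filter_fst_mem (Γ : Finset (Fin n × Fin n)) (S : Finset (Fin n)) :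
    (Γ.filter fun p => p.1 ∈ S).card = ∑ i ∈ S, (Γ.filter fun p => p.1 = i).card := by
  rw [Finset.card_eq_sum_card_fiberwise (f := Prod.fst) (t := S) fun p hp =>
    Finset.mem_coe.mpr (Finset.mem_filter.mp (Finset.mem_coe.mp hp)).2]
  refine Finset.sum_congr rfl fun i hi => ?_
  rw [Finset.filter_filter]
  congr 1
  ext p
  simp only [Finset.mem_filter]
  exact ⟨fun ⟨hp, _, h⟩ => ⟨hp, h⟩, fun ⟨hp, h⟩ => ⟨hp, h ▸ hi, h⟩⟩

/-- The row degrees of `Γ ⊆ [n]²` sum to `|Γ|`. [folklore] -/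
theorem sum_card_filter_fst_eq (Γ : Finset (Fin n × Fin n)) :
    ∑ i, (Γ.filter fun p => p.1 = i).card = Γ.card := by
  rw [← card_filter_fst_mem, Finset.filter_true_of_mem fun p _ => Finset.mem_univ p.1]

/-- The counting step: if `f : α → ℕ` has total sum `≤ |α| + 1`, its sum over `S` exceeds `|S|`,
and `f` is pointwise at least as large outside `S` as inside, then `S` is everything
(`|α| ≤ |S|`): some `i ∈ S` has `f i ≥ 2`, so `f ≥ 2` outside `S`, and
`|α| + 1 ≥ Σ f ≥ (|S| + 1) + 2 (|α| − |S|)`. [folklore] -/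
theorem card_univ_le_of_sum_lt {α : Type*} [Fintype α] [DecidableEq α] (f : α → ℕ)
    (S : Finset α) (hmono : ∀ i ∉ S, ∀ i' ∈ S, f i' ≤ f i) (hS : S.card < ∑ i ∈ S, f i)
    (htot : ∑ i, f i ≤ Fintype.card α + 1) : Fintype.card α ≤ S.card := by
  obtain ⟨i₁, hi₁, hlt⟩ : ∃ i ∈ S, 1 < f i := by
    apply Finset.exists_lt_of_sum_lt
    simpa using hS
  have h2 : ∀ i ∈ Sᶜ, 2 ≤ f i := by
    intro i hi
    have := hmono i (Finset.mem_compl.mp hi) i₁ hi₁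
    omega
  have hsplit := Finset.sum_add_sum_compl S f
  have hcompl : ∑ _i ∈ Sᶜ, 2 ≤ ∑ i ∈ Sᶜ, f i := Finset.sum_le_sum h2
  rw [Finset.sum_const, smul_eq_mul, Finset.card_compl] at hcompl
  have := S.card_le_univ
  omega

/-! ### Permutations below the identity in a linear key order -/

/-- A permutation `τ` of a finite set which does not increase an injective key into a linear
order (`key (τ i) ≤ key i` for all `i`) is the identity: `τ` maps the initial segment
`{i' : key i' ≤ key i}` injectively into itself, hence onto itself, and the preimage `i'` of `i`
satisfies `key i ≤ key i' ≤ key i`. [folklore] -/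
theorem perm_apply_eq_self_of_key_le {α β : Type*} [Fintype α] [DecidableEq α] [LinearOrder β]
    (key : α → β) (hkey : Function.Injective key) (τ : Equiv.Perm α)
    (hτ : ∀ i, key (τ i) ≤ key i) (i : α) : τ i = i := by
  set I : Finset α := Finset.univ.filter fun i' => key i' ≤ key i with hI
  have hsub : I.image τ ⊆ I := by
    intro x hx
    obtain ⟨i', hi', rfl⟩ := Finset.mem_image.mp hx
    simp only [hI, Finset.mem_filter, Finset.mem_univ, true_and] at hi' ⊢
    exact (hτ i').trans hi'
  have heq : I.image τ = I :=
    Finset.eq_of_subset_of_card_le hsub (Finset.card_image_of_injective I τ.injective).ge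
  have hi : i ∈ I.image τ := by
    rw [heq]
    simp [hI]
  obtain ⟨i', hi'I, hi'⟩ := Finset.mem_image.mp hi
  have h1 : key i' ≤ key i := by simpa [hI] using hi'I
  have h2 : key i ≤ key i' := hi' ▸ hτ i'
  obtain rfl : i = i' := hkey (le_antisymm h2 h1)
  exact hi'

/-! ### Hall's condition for the allowed sets -/

/-- **Hall's condition.**  Let `Γ ⊆ [n]²` with `|Γ| ≤ n + 1`, and let `key` order the rows so that
the row degree `d(i) = #{cells of Γ in row i}` is monotone along `key`.  With the allowed set of
column `j` being `A j = {i : key i ≤ key i' for every cell (i', j) ∈ Γ}`, every set `J` of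
columns satisfies `|J| ≤ |⋃_{j ∈ J} A j|`.  (If a column of `J` is empty its allowed set is
everything.  Otherwise let `i_j` be the key-minimal row of column `j ∈ J`, let `j⋆` maximise
`key i_j` over `J`, `S = A j⋆ ⊆ ⋃_J A j`; then `j ↦ (i_j, j)` injects `J` into the cells of `Γ`
with row in `S`, so `|J| ≤ Σ_{i ∈ S} d(i)`, and either this is `≤ |S|` or, by
`card_univ_le_of_sum_lt`, `|S| = n ≥ |J|`.) [folklore] -/
theorem hall_condition {β : Type*} [LinearOrder β] (Γ : Finset (Fin n × Fin n))
    (hΓ : Γ.card ≤ n + 1) (key : Fin n → β)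
    (hmono : ∀ i i', key i ≤ key i' →
      (Γ.filter fun p => p.1 = i).card ≤ (Γ.filter fun p => p.1 = i').card)
    (A : Fin n → Finset (Fin n)) (hAmem : ∀ j i, i ∈ A j ↔ ∀ i', (i', j) ∈ Γ → key i ≤ key i')
    (J : Finset (Fin n)) : J.card ≤ (J.biUnion A).card := by
  by_cases hcol : ∀ j ∈ J, ∃ i, (i, j) ∈ Γ
  swap
  · -- some column of `J` has no `Γ`-cell: its allowed set is everything
    push Not at hcol
    obtain ⟨j, hj, hjΓ⟩ := hcol
    have huniv : A j = Finset.univ := by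
      ext i
      simp only [hAmem, Finset.mem_univ, iff_true]
      exact fun i' hi' => absurd hi' (hjΓ i')
    calc J.card ≤ (Finset.univ : Finset (Fin n)).card := Finset.card_le_univ J
      _ = (A j).card := by rw [huniv]
      _ ≤ (J.biUnion A).card := Finset.card_le_card (Finset.subset_biUnion_of_mem A hj)
  rcases J.eq_empty_or_nonempty with hJ | ⟨j₀, hj₀⟩
  · simp [hJ]
  haveI : Nonempty (Fin n) := ⟨j₀⟩
  -- the key-minimal row `mrow j` of every column `j ∈ J`
  have hmin : ∀ j ∈ J, ∃ i, (i, j) ∈ Γ ∧ ∀ i', (i', j) ∈ Γ → key i ≤ key i' := by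
    intro j hj
    obtain ⟨i, hi⟩ := hcol j hj
    obtain ⟨i₀, hi₀, hle⟩ := Finset.exists_min_image (Finset.univ.filter fun i' => (i', j) ∈ Γ)
      key ⟨i, by simpa using hi⟩
    exact ⟨i₀, by simpa using hi₀, fun i' hi' => hle i' (by simpa using hi')⟩
  choose! mrow hmrowΓ hmrowmin using hmin
  -- `js` maximises the key of the minimal row; `S := A js` is the largest allowed set over `J`
  obtain ⟨js, hjs, hmax⟩ := Finset.exists_max_image J (fun j => key (mrow j)) ⟨j₀, hj₀⟩
  have hS : ∀ i, i ∈ A js ↔ key i ≤ key (mrow js) := fun i =>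
    (hAmem js i).trans
      ⟨fun h => h _ (hmrowΓ js hjs), fun h i' hi' => h.trans (hmrowmin js hjs i' hi')⟩
  -- `j ↦ (mrow j, j)` injects `J` into the cells of `Γ` with row in `S`
  have h1 : J.card ≤ (Γ.filter fun p => p.1 ∈ A js).card := by
    refine Finset.card_le_card_of_injOn (fun j => (mrow j, j)) (fun j hj => ?_) ?_
    · exact Finset.mem_coe.mpr
        (Finset.mem_filter.mpr ⟨hmrowΓ j (Finset.mem_coe.mp hj), (hS _).mpr (hmax j hj)⟩)
    · intro j _ j' _ h
      exact congrArg Prod.snd h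
  have h2 : (Γ.filter fun p => p.1 ∈ A js).card =
      ∑ i ∈ A js, (Γ.filter fun p => p.1 = i).card :=
    card_filter_fst_mem Γ (A js)
  have h3 : (A js).card ≤ (J.biUnion A).card :=
    Finset.card_le_card (Finset.subset_biUnion_of_mem A hjs)
  by_cases h4 : ∑ i ∈ A js, (Γ.filter fun p => p.1 = i).card ≤ (A js).card
  · exact h1.trans (h2.le.trans (h4.trans h3))
  push Not at h4
  -- otherwise `S` is everything
  have hkeymono : ∀ i ∉ A js, ∀ i' ∈ A js,
      (Γ.filter fun p => p.1 = i').card ≤ (Γ.filter fun p => p.1 = i).card := by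
    intro i hi i' hi'
    rw [hS] at hi hi'
    exact hmono i' i (hi'.trans (le_of_not_ge hi))
  have htot : ∑ i, (Γ.filter fun p => p.1 = i).card ≤ Fintype.card (Fin n) + 1 := by
    rw [sum_card_filter_fst_eq, Fintype.card_fin]
    exact hΓ
  -- (the hypotheses are passed through `refine`/`exact`: elaborating them as direct arguments
  -- next to the explicit `fun i => …` makes the unifier time out)
  have hn : Fintype.card (Fin n) ≤ (A js).card := by
    refine card_univ_le_of_sum_lt (fun i => (Γ.filter fun p => p.1 = i).card) (A js) ?_ ?_ ?_
    · exact hkeymono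
    · exact h4
    · exact htot
  rw [Fintype.card_fin] at hn
  calc J.card ≤ n := by simpa using Finset.card_le_univ J
    _ ≤ (A js).card := hn
    _ ≤ (J.biUnion A).card := h3

/-! ### The combinatorial core: a rigid permutation -/

/-- **Rigid permutations.**  For every set `Γ ⊆ [n]²` of at most `n + 1` cells there is a
permutation `ρ` (occupying the cells `(ρ j, j)`) which is the unique perfect matching of
`graph(ρ) ∪ Γ`: every permutation `σ` with `σ j = ρ j ∨ (σ j, j) ∈ Γ` for all columns `j` equals
`ρ`.  (Hall's theorem for the allowed sets of `hall_condition` with the key `i ↦ (d(i), i)`, then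
`perm_apply_eq_self_of_key_le` for `ρ ∘ σ⁻¹`.)  Sharp: `|Γ| = n + 2` fails already at `n = 2`
(`Γ` = all four cells). [folklore] -/
theorem exists_rigid_perm (Γ : Finset (Fin n × Fin n)) (hΓ : Γ.card ≤ n + 1) :
    ∃ ρ : Equiv.Perm (Fin n), ∀ σ : Equiv.Perm (Fin n),
      (∀ j, σ j = ρ j ∨ (σ j, j) ∈ Γ) → σ = ρ := by
  -- the key `i ↦ (d(i), i)`, lexicographic
  obtain ⟨key, hkey, hmono⟩ : ∃ key : Fin n → ℕ ×ₗ Fin n, Function.Injective key ∧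
      ∀ i i', key i ≤ key i' →
        (Γ.filter fun p => p.1 = i).card ≤ (Γ.filter fun p => p.1 = i').card := by
    refine ⟨fun i => toLex ((Γ.filter fun p => p.1 = i).card, i), fun i i' h => ?_,
      fun i i' h => ?_⟩
    · simpa using congrArg (fun x => (ofLex x).2) h
    · rcases Prod.Lex.toLex_le_toLex.mp h with h | ⟨h, -⟩
      exacts [h.le, h.le]
  -- Hall
  obtain ⟨π, hπinj, hπA⟩ :=
    (Finset.all_card_le_biUnion_card_iff_exists_injective
        (fun j => Finset.univ.filter fun i => ∀ i', (i', j) ∈ Γ → key i ≤ key i')).mp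
      (hall_condition Γ hΓ key hmono _ fun j i => by simp)
  obtain ⟨ρ, hρ⟩ : ∃ ρ : Equiv.Perm (Fin n), ∀ j i', (i', j) ∈ Γ → key (ρ j) ≤ key i' := by
    refine ⟨Equiv.ofBijective π (Finite.injective_iff_bijective.mp hπinj), fun j i' hi' => ?_⟩
    have hj := hπA j
    simp only [Finset.mem_filter, Finset.mem_univ, true_and] at hj
    exact hj i' hi'
  refine ⟨ρ, fun σ hσ => ?_⟩
  -- uniqueness
  have hle : ∀ j, key (ρ j) ≤ key (σ j) := by
    intro j
    rcases hσ j with h | h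
    · rw [h]
    · exact hρ j _ h
  have hτ : ∀ i, key ((σ.symm.trans ρ) i) ≤ key i := by
    intro i
    have h := hle (σ.symm i)
    rwa [Equiv.apply_symm_apply] at h
  refine Equiv.ext fun j => ?_
  have h := perm_apply_eq_self_of_key_le key hkey (σ.symm.trans ρ) hτ (σ j)
  rw [Equiv.trans_apply, Equiv.symm_apply_apply] at h
  exact h.symm

/-! ### Coefficient extraction -/

/-- **Coefficient extraction.**  If `ρ` is the unique perfect matching of `graph(ρ) ∪ supp γ`
then `coeff (μ_ρ + γ) (per_n · q) = coeff γ q`: in `per_n · q = Σ_σ x^{μ_σ} · q`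
(`perPoly_eq_sum_monomial`) the term of `σ` contributes `[μ_σ ≤ μ_ρ + γ] · q_{μ_ρ + γ − μ_σ}`
(`coeff_monomial_mul'`), and `μ_σ ≤ μ_ρ + γ` forces `σ j = ρ j ∨ (σ j, j) ∈ supp γ` for every
column `j` (`permMonomial_apply`), hence `σ = ρ`. [folklore] -/
theorem coeff_permMonomial_add_mul (ρ : Equiv.Perm (Fin n)) (γ : (Fin n × Fin n) →₀ ℕ)
    (q : MvPolynomial (Fin n × Fin n) ℝ)
    (huniq : ∀ σ : Equiv.Perm (Fin n), (∀ j, σ j = ρ j ∨ (σ j, j) ∈ γ.support) → σ = ρ) :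
    coeff (permMonomial ρ + γ) (perPoly (Fin n) ℝ * q) = coeff γ q := by
  rw [perPoly_eq_sum_monomial (n := Fin n) ℝ, Finset.sum_mul, coeff_sum,
    Finset.sum_eq_single ρ]
  · rw [coeff_monomial_mul', if_pos le_self_add, one_mul, add_tsub_cancel_left]
  · intro σ _ hσ
    rw [coeff_monomial_mul', if_neg]
    intro hle
    refine hσ (huniq σ fun j => ?_)
    have h := Finsupp.le_def.mp hle (σ j, j)
    simp only [Finsupp.coe_add, Pi.add_apply, permMonomial_apply] at h
    by_cases hj : ρ j = σ j
    · exact Or.inl hj.symm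
    · rw [if_neg hj, zero_add] at h
      exact Or.inr (Finsupp.mem_support_iff.mpr (Nat.one_le_iff_ne_zero.mp h))
  · intro h
    exact absurd (Finset.mem_univ ρ) h

/-! ### The stub -/

/-- **stub_automaticPositivity — automatic positivity of low-degree cofactors.**  If `per_n · q`
has nonnegative coefficients and `deg q ≤ n + 1` then `q` has nonnegative coefficients: for an
exponent `γ ∈ supp q` the support `Γ = supp γ` has `|Γ| ≤ Σ γ ≤ deg q ≤ n + 1` cells
(`MvPolynomial.le_totalDegree`), `exists_rigid_perm` gives the rigid permutation `ρ` of `Γ`, and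
`q_γ = coeff (μ_ρ + γ) (per_n · q) ≥ 0` (`coeff_permMonomial_add_mul`).  Sharp:
`per₂ · (a² − ab + b²) = a³ + b³`, `deg = 4 = n + 2`. [folklore] -/
theorem stub_automaticPositivity (n : ℕ) (q : MvPolynomial (Fin n × Fin n) ℝ)
    (hdeg : q.totalDegree ≤ n + 1)
    (hpos : ∀ m, 0 ≤ coeff m (perPoly (Fin n) ℝ * q)) :
    ∀ m, 0 ≤ coeff m q := by
  intro γ
  by_cases hγ : γ ∈ q.support
  · have hcard : γ.support.card ≤ n + 1 :=
      calc γ.support.card = ∑ c ∈ γ.support, 1 := Finset.card_eq_sum_ones _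
        _ ≤ ∑ c ∈ γ.support, γ c := Finset.sum_le_sum fun c hc =>
            Nat.one_le_iff_ne_zero.mpr (Finsupp.mem_support_iff.mp hc)
        _ = γ.sum fun _ e => e := rfl
        _ ≤ q.totalDegree := le_totalDegree hγ
        _ ≤ n + 1 := hdeg
    obtain ⟨ρ, hρ⟩ := exists_rigid_perm γ.support hcard
    rw [← coeff_permMonomial_add_mul ρ γ q hρ]
    exact hpos _
  · rw [notMem_support_iff.mp hγ]

end Summit.ValiantsHypothesis.ValiantsHypothesis.Theorems.DivisionGap.PerCofactorDegreeReduction.AutomaticPositivity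

end
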